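import Mathlib
import HarnessLib
import Summits.ResolutionOfSingularities.ResolutionOfSingularities.Theorems.WildQuotientsWildQuotientResolutionS1aExtendRees

/-!
# S1a — THE KILL HALF IN LOCAL FORM: `KillLocalReach p ⇒ KillFamilyReach p`

[OURS · L1 W4.5c · lead-1 g8; companion of `…S1aKillFamily` (p614162) and `…S1aExtendRees` (p615490)] — NOT statements of the manuscript; counted 0;
AI-level work, weaker than expert review. Crux stmt-ResolutionOfSingularities-17941, line `s1a-logminvertex` v7, research stub `stub_killFamilyReach`.

* `KillLocalReach p` (OURS CANDIDATE research statement, asserted nowhere): at every reachable non-terminal model with `jInf = ⊥`, finitely many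
  `G`-stable OPENS `Uᵢ` carrying PRINCIPAL CENTRES `𝒦ᵢ` (one degree `d`) for the restricted actions, with CLOSED, PAIRWISE DISJOINT support images,
  the images of whose kill charts cover the bad locus — the form in which the census produces kills (one canonical kill per bad component, on a
  neighbourhood of the component);
* ★ `killFamilyReach_of_killLocalReach` — by `ExtendRees.exists_isPrincipalCentre_of_local` (extension by the unit filtration) member by member.
-/

set_option linter.dupNamespace false

noncomputable section

open CategoryTheory Limits AlgebraicGeometry TopologicalSpace Topology
open Literature.AlgebraicGeometry.Resolution Literature.AlgebraicGeometry.RelativeSpec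
open Summit.ResolutionOfSingularities.ResolutionOfSingularities.Theorems.WildQuotientResolution.S1
open Summit.ResolutionOfSingularities.ResolutionOfSingularities.Theorems.WildQuotientResolution.S1.NodeAtlas
open Summit.ResolutionOfSingularities.ResolutionOfSingularities.Theorems.WildQuotientResolution.S1.KillFamily
open Summit.ResolutionOfSingularities.ResolutionOfSingularities.Theorems.WildQuotientResolution.S1.ExtendRees

namespace Summit.ResolutionOfSingularities.ResolutionOfSingularities.Theorems.WildQuotientResolution.S1

/-- **`KillLocalReach p`** (OURS CANDIDATE research statement, asserted nowhere; the K side in LOCAL form): at every non-terminal model reachable from the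
initial model of a crux datum with every bad point killable (`jInf = ⊥`), there are finitely many `G`-stable opens `Uᵢ ⊆ M.V` with PRINCIPAL CENTRES
`𝒦ᵢ` of one Veronese degree `d > 0` for the restricted actions `M.act.restrict Uᵢ`, whose supports `supp (𝒦ᵢ)_d` have CLOSED and PAIRWISE DISJOINT
images in `M.V`, such that every bad point of `M` is the image of a point of a principal-centre chart of some `𝒦ᵢ`. (Census reading: `Uᵢ` = a
`G`-stable neighbourhood of the `i`-th bad component, `𝒦ᵢ` = the canonical LP-minimal `(2,1)`-type kill along it — (K1); closed support = the
component — (K3).) [OURS · L1 W4.5c] -/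
def KillLocalReach (p : ℕ) : Prop :=
  ∀ (k : Type) [Field k] [CharP k p] [PerfectField k] (X' X₁ : Scheme.{0})
    (f : X₁ ⟶ Spec (.of k)) (q : X' ⟶ X₁) (G : Type) [Group G] [Finite G]
    (ρ : G →* Aut X'), Nat.card G = p → IsSeparated f → LocallyOfFiniteType f → QuasiCompact f →
    IsIntegral X₁ → ∀ [IsIntegral X'], Scheme.IsRegular X' → IsFinite q → Function.Surjective q.base →
    (∃ U : X₁.Opens, Dense (U : Set X₁) ∧ Etale (q ∣_ U)) →
    ∀ (hq : ∀ g : G, (ρ g).hom ≫ q = q),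
    (∀ x y : X', q.base x = q.base y → ∃ g : G, (ρ g).hom.base x = y) →
    topologicalKrullDim X₁ ≤ 4 → Function.Injective ρ →
    ∀ (g₀ : G), (∀ g : G, g ∈ Subgroup.zpowers g₀) → ∀ [IsLocallyNoetherian X']
      (h₀ : NodeAtlas p (⟨ρ, hq⟩ : ActionOver q G) g₀),
      ∀ M : GameFrame.GModel p q G ρ g₀, (GameFrame.GModel.initial hq h₀).Reachable M → ¬ M.Terminal → M.jInf = ⊥ →
        ∃ (n : ℕ) (U : Fin n → M.V.Opens) (hU : ∀ (i : Fin n) (g : G), (M.act.aut g).hom ⁻¹ᵁ U i = U i)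
          (𝒦 : (i : Fin n) → ReesFiltration ((U i : M.V.Opens) : Scheme.{0})) (d : ℕ), 0 < d ∧
          (∀ i, IsPrincipalCentre p (M.act.restrict (U i) (hU i)) g₀ (𝒦 i) d) ∧
          (∀ i, IsClosed ((U i).ι.base '' ((((𝒦 i).ideal d).support : Set ((U i : M.V.Opens) : Scheme.{0}))))) ∧
          (Pairwise fun i j => Disjoint ((U i).ι.base '' ((((𝒦 i).ideal d).support : Set ((U i : M.V.Opens) : Scheme.{0}))))
            ((U j).ι.base '' ((((𝒦 j).ideal d).support : Set ((U j : M.V.Opens) : Scheme.{0}))))) ∧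
          ∀ v ∈ M.badLocus, ∃ (i : Fin n) (O₀ : (M.act.restrict (U i) (hU i)).StableAffineOpens) (u : ((U i : M.V.Opens) : Scheme.{0})),
            IsPrincipalCentreChart p (M.act.restrict (U i) (hU i)) g₀ (𝒦 i) d O₀ ∧ u ∈ O₀.1 ∧ (U i).ι.base u = v

/-- ★ **LOCAL FORM ⇒ FAMILY FORM**: `KillLocalReach p ⇒ KillFamilyReach p` — extend each local principal centre by the unit filtration
(`ExtendRees.exists_isPrincipalCentre_of_local`); supports and kill-opens are as required. [OURS · L1 W4.5c] -/
theorem killFamilyReach_of_killLocalReach {p : ℕ} (h : KillLocalReach p) : KillFamilyReach p := by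
  intro k _ _ _ X' X₁ f q G _ _ ρ hG hfs hfft hfqc hX₁ _ hreg hqfin hqs hqet hq horb hdim hinj g₀ hg₀ _ h₀ M hR hT hj
  obtain ⟨n, U, hU, 𝒦, d, hd, hprin, hC, hdisj, hcov⟩ :=
    h k X' X₁ f q G ρ hG hfs hfft hfqc hX₁ hreg hqfin hqs hqet hq horb hdim hinj g₀ hg₀ h₀ M hR hT hj
  choose 𝒦' h𝒦' hsupp hkill using fun i => exists_isPrincipalCentre_of_local M (U i) (hU i) (𝒦 i) (hprin i) (hC i)
  refine ⟨n, 𝒦', d, hd, h𝒦', fun i j hij => ?_, fun v hv => ?_⟩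
  · change Disjoint ((((𝒦' i).ideal d).support : Set M.V)) (((𝒦' j).ideal d).support : Set M.V)
    rw [hsupp i, hsupp j]
    exact hdisj hij
  · obtain ⟨i, O₀, u, hO₀, hu, rfl⟩ := hcov v hv
    exact Set.mem_iUnion.mpr ⟨i, hkill i O₀ hO₀ u hu⟩

end Summit.ResolutionOfSingularities.ResolutionOfSingularities.Theorems.WildQuotientResolution.S1

end
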